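import Summits.AtomisticToContinuum.HydrodynamicLimit.Theorems.AntiMazurCoboundariesCellForecastPressureDecayEnskogObjects
import Literature.Probability.Distributions.StdGaussianDensity
import HarnessLib

/-!
# S2a · the canonical cell law factorises (stub `stub_cellLawFactorises` of the crux line
# `enskog-compensator-martingale`, crux `CellForecastPressureDecay`, stmt-AtomisticToContinuum-13915)

The canonical cell Gibbs law `P_{n,L} = cellLaw σ L n Ψ` of `n` hard spheres of diameter `σ` in the
cube `[0,L]³` with Maxwellian velocities has Lebesgue density
`𝒵⁻¹ · 1_D(z) · ∏ᵢ 1_{[0,L]³}(xᵢ) M(vᵢ)` on `Cell n = (Fin n → V3 × V3)` (`D` the hard-sphere domain,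
`𝒵 = canonicalPartition`).  We prove the registered obligation `CellLawFactorises σ` for every `σ`:
pushing `P_{n,L}` forward along `z ↦ (positions, velocities)` gives the product of the uniform law
`posLaw σ L n` on the admissible position set with the `n`-fold product of standard Gaussians,
`(pos, vel)_* P_{n,L} = posLaw ⊗ γ^{⊗n}`.

Route (the Euclidean-cube twin of `localGibbsMeasure_rung0_eq_map`,
`Literature/MathematicalPhysics/KineticTheory/HardSphereUniformGas.lean`):
* `z ↦ (pos z, vel z)` is the volume-preserving measurable equivalence
  `MeasurableEquiv.arrowProdEquivProdArrow V3 V3 (Fin n)`, so the push-forward of a measure with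
  density is the product Lebesgue measure with the transported density
  (`map_withDensity_of_measurePreserving`);
* the transported weight factorises pointwise, `1_D ∏ᵢ 1_{[0,L]³}(xᵢ) M(vᵢ) = 1_adm(x) ∏ᵢ M(vᵢ)`
  (`ofReal_indicator_tensorPow_cellRef`), whence
  `(1_D f₀^{⊗n} dz) ∘ (pos, vel)⁻¹ = dx|_adm ⊗ γ^{⊗n}` (`map_withDensity_cellWeight`; `prod_withDensity`,
  `pi_withDensity_eq`, `stdGaussian = M dv`);
* taking total masses, `𝒵 = vol(adm)` (`canonicalPartition_cell_eq_toReal_posZ`), and the two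
  normalisations `ENNReal.ofReal 𝒵⁻¹`, `vol(adm)⁻¹` agree (both sides are the zero measure when
  `vol(adm) = 0`).

References: H. Spohn, *Large Scale Dynamics of Interacting Particles* (1991), Part I §2.3
(equilibrium measures of hard spheres factorise into configurational and Maxwellian parts); Fubini–Tonelli.
-/

noncomputable section

open MeasureTheory ProbabilityTheory Set Filter
open scoped ENNReal BigOperators InnerProductSpace
open Literature.Analysis.FluidPDE Literature.MathematicalPhysics.KineticTheory
open Summit.AtomisticToContinuum.HydrodynamicLimit.Theorems.CellForecastPressureDecay
  (cellRef cellRef_nonneg measurable_cellRef cellCube measurableSet_cellCube)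

namespace Summit.AtomisticToContinuum.HydrodynamicLimit.Theorems.EnskogCompensator

/-- The admissible position set `adm = {x | hard core, every centre in [0,L]³}` is measurable. [folklore] -/
theorem measurableSet_posAdmissible (σ L : ℝ) (n : ℕ) : MeasurableSet (posAdmissible σ L n) := by
  have h1 : MeasurableSet {x : Fin n → V3 | ∀ i j, i ≠ j → σ ≤ ‖x i - x j‖} := by
    have : {x : Fin n → V3 | ∀ i j, i ≠ j → σ ≤ ‖x i - x j‖} =
        (fun x : Fin n → V3 => fun i => (x i, (0 : V3))) ⁻¹'
          hardSphereDomain (Euclidean.geometry (Fin 3)) n σ := by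
      ext x
      rw [mem_preimage, mem_hardSphereDomain]
      rfl
    rw [this]
    exact (measurableSet_hardSphereDomain _ Euclidean.measurable_geometry_sepVec n σ).preimage
      (measurable_pi_lambda _ fun i => (measurable_pi_apply i).prodMk measurable_const)
  have h2 : MeasurableSet {x : Fin n → V3 | ∀ i k, x i k ∈ Set.Icc (0 : ℝ) L} := by
    have : {x : Fin n → V3 | ∀ i k, x i k ∈ Set.Icc (0 : ℝ) L} = ⋂ i, (fun x => x i) ⁻¹' cellCube L := by
      ext x
      simp [cellCube, Set.mem_iInter]
    rw [this]
    exact MeasurableSet.iInter fun i => (measurableSet_cellCube L).preimage (measurable_pi_apply i)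
  exact h1.inter h2

/-- **Pointwise factorisation of the cell weight.** At the configuration with positions `x` and
velocities `v`, `1_D · ∏ᵢ 1_{[0,L]³}(xᵢ) M(vᵢ) = 1_adm(x) · ∏ᵢ M(vᵢ)` (in `ℝ≥0∞`): the hard-core
constraint only sees the positions (`Euclidean.geometry_sepVec`). [folklore] -/
theorem ofReal_indicator_tensorPow_cellRef (σ L : ℝ) {n : ℕ} (x v : Fin n → V3) :
    ENNReal.ofReal ((hardSphereDomain (Euclidean.geometry (Fin 3)) n σ).indicator
        (tensorPow n (cellRef L)) (fun i => (x i, v i))) =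
      (posAdmissible σ L n).indicator 1 x * ∏ i, ENNReal.ofReal (globalMaxwellian (v i)) := by
  by_cases hD : (fun i => (x i, v i)) ∈ hardSphereDomain (Euclidean.geometry (Fin 3)) n σ
  · by_cases hcube : ∀ i k, x i k ∈ Set.Icc (0 : ℝ) L
    · have hx : x ∈ posAdmissible σ L n :=
        ⟨fun i j hij => by simpa using (mem_hardSphereDomain.1 hD) i j hij, hcube⟩
      rw [indicator_of_mem hD, indicator_of_mem hx, Pi.one_apply, one_mul, tensorPow,
        ← ENNReal.ofReal_prod_of_nonneg fun i _ => (globalMaxwellian_pos (v i)).le]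
      congr 1
      refine Finset.prod_congr rfl fun i _ => ?_
      have hxi : x i ∈ {y : V3 | ∀ k, y k ∈ Set.Icc (0 : ℝ) L} := hcube i
      simp only [cellRef, indicator_of_mem hxi, one_mul]
    · have hx : x ∉ posAdmissible σ L n := fun h => hcube h.2
      obtain ⟨i, hi⟩ := not_forall.1 hcube
      rw [indicator_of_mem hD, indicator_of_notMem hx, zero_mul, tensorPow,
        Finset.prod_eq_zero (Finset.mem_univ i), ENNReal.ofReal_zero]
      have hxi : x i ∉ {y : V3 | ∀ k, y k ∈ Set.Icc (0 : ℝ) L} := hi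
      simp only [cellRef, indicator_of_notMem hxi, zero_mul]
  · have hx : x ∉ posAdmissible σ L n := fun h =>
      hD (mem_hardSphereDomain.2 fun i j hij => by simpa using h.1 i j hij)
    rw [indicator_of_notMem hD, indicator_of_notMem hx, zero_mul, ENNReal.ofReal_zero]

/-- **The unnormalised cell weight factorises**: pushing `1_D f₀^{⊗n} dz` (`f₀ = cellRef L`) forward
along `z ↦ (pos z, vel z)` gives `dx|_adm ⊗ γ^{⊗n}`, `γ = stdGaussian V3 = M dv`
(`volume_measurePreserving_arrowProdEquivProdArrow`, `prod_withDensity`, `pi_withDensity_eq`). [folklore] -/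
theorem map_withDensity_cellWeight (σ L : ℝ) (n : ℕ) :
    ((volume : Measure (Cell n)).withDensity fun z => ENNReal.ofReal
        ((hardSphereDomain (Euclidean.geometry (Fin 3)) n σ).indicator (tensorPow n (cellRef L)) z)).map
      (fun z => (pos z, vel z)) =
    ((volume : Measure (Fin n → V3)).restrict (posAdmissible σ L n)).prod
      (Measure.pi fun _ : Fin n => stdGaussian V3) := by
  set e := MeasurableEquiv.arrowProdEquivProdArrow V3 V3 (Fin n) with he
  have hpv : (fun z : Cell n => (pos z, vel z)) = ⇑e := rfl
  have hmp : MeasurePreserving (⇑e) volume volume :=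
    volume_measurePreserving_arrowProdEquivProdArrow V3 V3 (Fin n)
  rw [hpv, Literature.Probability.Distributions.map_withDensity_of_measurePreserving e hmp]
  have hγ : stdGaussian V3 =
      (volume : Measure V3).withDensity (fun v => ENNReal.ofReal (globalMaxwellian v)) :=
    stdGaussian_eq_withDensity_globalMaxwellian_holds
  have hm : Measurable fun v : V3 => ENNReal.ofReal (globalMaxwellian v) :=
    continuous_globalMaxwellian.measurable.ennreal_ofReal
  have hpi : (Measure.pi fun _ : Fin n => stdGaussian V3) =
      (volume : Measure (Fin n → V3)).withDensity
        (fun v => ∏ i, ENNReal.ofReal (globalMaxwellian (v i))) := by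
    rw [hγ, volume_pi]
    exact pi_withDensity_eq (fun _ => volume) (fun _ => hm) (fun _ => inferInstance)
  have hadm := measurableSet_posAdmissible σ L n
  have hprod : Measurable fun v : Fin n → V3 => ∏ i, ENNReal.ofReal (globalMaxwellian (v i)) :=
    Finset.measurable_prod _ fun i _ => hm.comp (measurable_pi_apply i)
  rw [hpi, ← withDensity_indicator_one hadm, prod_withDensity (measurable_one.indicator hadm) hprod,
    ← Measure.volume_eq_prod]
  congr 1
  funext p
  exact ofReal_indicator_tensorPow_cellRef σ L p.1 p.2

/-- **The cell partition function is the volume of the admissible position set** (the Maxwellians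
integrate to one): `𝒵 = vol(adm)` as real numbers (total masses in `map_withDensity_cellWeight`). [folklore] -/
theorem canonicalPartition_cell_eq_toReal_posZ (σ L : ℝ) (n : ℕ) :
    canonicalPartition (Euclidean.geometry (Fin 3)) σ n (cellRef L) = (posZ σ L n).toReal := by
  have hD : MeasurableSet (hardSphereDomain (Euclidean.geometry (Fin 3)) n σ) :=
    measurableSet_hardSphereDomain _ Euclidean.measurable_geometry_sepVec n σ
  have hT : Measurable (tensorPow n (cellRef L) : Cell n → ℝ) :=
    measurable_tensorPow (measurable_cellRef L) n
  have hF0 : ∀ z : Cell n, 0 ≤ (hardSphereDomain (Euclidean.geometry (Fin 3)) n σ).indicator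
      (tensorPow n (cellRef L)) z := fun z =>
    Set.indicator_nonneg (fun w _ => tensorPow_nonneg (cellRef_nonneg L) n w) z
  rw [canonicalPartition, integral_eq_lintegral_of_nonneg_ae (Eventually.of_forall hF0)
    (hT.indicator hD).aestronglyMeasurable]
  congr 1
  have hmeas : Measurable (fun z : Cell n => (pos z, vel z)) :=
    (MeasurableEquiv.arrowProdEquivProdArrow V3 V3 (Fin n)).measurable
  calc ∫⁻ z, ENNReal.ofReal ((hardSphereDomain (Euclidean.geometry (Fin 3)) n σ).indicator
          (tensorPow n (cellRef L)) z)
      = ((volume : Measure (Cell n)).withDensity fun z => ENNReal.ofReal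
          ((hardSphereDomain (Euclidean.geometry (Fin 3)) n σ).indicator
            (tensorPow n (cellRef L)) z)) univ := by
        rw [withDensity_apply _ MeasurableSet.univ, Measure.restrict_univ]
    _ = (((volume : Measure (Cell n)).withDensity fun z => ENNReal.ofReal
          ((hardSphereDomain (Euclidean.geometry (Fin 3)) n σ).indicator
            (tensorPow n (cellRef L)) z)).map (fun z => (pos z, vel z))) univ := by
        rw [Measure.map_apply hmeas MeasurableSet.univ, Set.preimage_univ]
    _ = ((volume : Measure (Fin n → V3)).restrict (posAdmissible σ L n)).prod
          (Measure.pi fun _ : Fin n => stdGaussian V3) univ := by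
        rw [map_withDensity_cellWeight]
    _ = posZ σ L n := by
        rw [← Set.univ_prod_univ, Measure.prod_prod, Measure.restrict_apply_univ, measure_univ,
          mul_one]
        rfl

/-- The cell law is the normalised, unrestricted weight: `P_{n,L} = (ENNReal.ofReal 𝒵⁻¹) • 1_D f₀^{⊗n} dz`
(restricting Lebesgue measure to `D` is redundant in front of the indicator `1_D`). [folklore] -/
theorem cellLaw_eq_smul_withDensity (σ L : ℝ) (n : ℕ) (Ψ : Flows σ) :
    cellLaw σ L n Ψ =
      ENNReal.ofReal (canonicalPartition (Euclidean.geometry (Fin 3)) σ n (cellRef L))⁻¹ •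
        (volume : Measure (Cell n)).withDensity fun z => ENNReal.ofReal
          ((hardSphereDomain (Euclidean.geometry (Fin 3)) n σ).indicator (tensorPow n (cellRef L)) z) := by
  have hD : MeasurableSet (hardSphereDomain (Euclidean.geometry (Fin 3)) n σ) :=
    measurableSet_hardSphereDomain _ Euclidean.measurable_geometry_sepVec n σ
  have hF0 : ∀ z : Cell n, 0 ≤ (hardSphereDomain (Euclidean.geometry (Fin 3)) n σ).indicator
      (tensorPow n (cellRef L)) z := fun z =>
    Set.indicator_nonneg (fun w _ => tensorPow_nonneg (cellRef_nonneg L) n w) z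
  rw [cellLaw, particleLaw_eq, liouville_eq]
  have hdens : (fun z : Cell n => ENNReal.ofReal
      (canonicalDensity (Euclidean.geometry (Fin 3)) σ n (cellRef L) z)) =
      ENNReal.ofReal (canonicalPartition (Euclidean.geometry (Fin 3)) σ n (cellRef L))⁻¹ •
        fun z => ENNReal.ofReal ((hardSphereDomain (Euclidean.geometry (Fin 3)) n σ).indicator
          (tensorPow n (cellRef L)) z) := by
    funext z
    simp only [Pi.smul_apply, smul_eq_mul, canonicalDensity]
    exact ENNReal.ofReal_mul' (hF0 z)
  have hsupp : (hardSphereDomain (Euclidean.geometry (Fin 3)) n σ).indicator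
      (fun z : Cell n => ENNReal.ofReal ((hardSphereDomain (Euclidean.geometry (Fin 3)) n σ).indicator
        (tensorPow n (cellRef L)) z)) =
      fun z => ENNReal.ofReal ((hardSphereDomain (Euclidean.geometry (Fin 3)) n σ).indicator
        (tensorPow n (cellRef L)) z) := by
    funext z
    by_cases hz : z ∈ hardSphereDomain (Euclidean.geometry (Fin 3)) n σ
    · rw [indicator_of_mem hz]
    · rw [indicator_of_notMem hz, indicator_of_notMem hz, ENNReal.ofReal_zero]
  rw [hdens, withDensity_smul' _ _ ENNReal.ofReal_ne_top, ← withDensity_indicator hD, hsupp]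

/-- **S2a · the cell law factorises** (registered stub `stub_cellLawFactorises` of the line
`enskog-compensator-martingale`): for every diameter `σ`, every cell `[0,L]³`, particle number `n` and
cluster dynamics `Ψ`, `(pos, vel)_* P_{n,L} = posLaw σ L n ⊗ (stdGaussian V3)^{⊗n}` — under the canonical
cell law the velocities are i.i.d. standard Maxwellian and independent of the positions, which are
uniform on the admissible set; both sides are the zero measure when the admissible set is null. [folklore] -/
theorem stub_cellLawFactorises : ∀ σ : ℝ, CellLawFactorises σ := by
  intro σ L n Ψ
  rw [cellLaw_eq_smul_withDensity, Measure.map_smul, map_withDensity_cellWeight, posLaw,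
    Measure.prod_smul_left, canonicalPartition_cell_eq_toReal_posZ]
  rcases eq_or_ne (posZ σ L n) 0 with h0 | h0
  · have hres : (volume : Measure (Fin n → V3)).restrict (posAdmissible σ L n) = 0 :=
      Measure.restrict_eq_zero.2 h0
    rw [hres, Measure.zero_prod, smul_zero, smul_zero]
  rcases eq_or_ne (posZ σ L n) ⊤ with htop | htop
  · rw [htop, ENNReal.toReal_top, inv_zero, ENNReal.ofReal_zero, ENNReal.inv_top]
  · rw [ENNReal.ofReal_inv_of_pos (ENNReal.toReal_pos h0 htop), ENNReal.ofReal_toReal htop]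

end Summit.AtomisticToContinuum.HydrodynamicLimit.Theorems.EnskogCompensator

end
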